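import Literature.MathematicalPhysics.QuantumFieldTheory.Balaban1983to89.Node00.Record13NumericsOfThm1CCMZChi
import Literature.MathematicalPhysics.QuantumFieldTheory.Balaban1983to89.Node00.Record13SepCoPLiveSelectorChi
import Literature.MathematicalPhysics.QuantumFieldTheory.Balaban1983to89.Node00.Record13SepCoPRInhabitedOfSepCoPChi

/-!
# NODE 00 — K0 σ-CLOSURE χ-EDITIONS, SECOND TRANCHE, FILE F8 (dag-lead g40 WORDS 58x HANDS-3 H3.1 ∕ WORDS 587 GO; RR-2 g26 INTENT T2): ★★★ THE ⁵ SOCKET OF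
# `Record13SepCoPLiveSelectorZ` RE-ISSUED GENERIC IN THE β-SLOT χ — `Provisos₁₃SepCoPChi` at node00-def-Y's all-numerics live family with the letters in the χ slot
# `theta13LiveOfNumericsZChi … χ` FROM THE (7)-GUARDED SEPARATED ROW AT THE Co CARRIER THERE ALONE (`provisos₁₃SepCoP_theta13LiveOfNumericsZ_of_bgSepCoP_chi`), the ⁵-LEVEL
# K0 BODY AT `N = 2` generic in χ (`exists_k0SepCoP_of_bgSepCoP_theta13LiveOfNumericsZ_chi`), and — THE PIECE THE K0ᴬ ROAD CONSUMES — ITS RE-CENTRED INSTANCE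
# `exists_k0SepCoP_of_bgSepCoP_theta13LiveOfNumericsZAx`, whose conclusion `∃ θ : Stage13Params F 2, θ.Provisos₁₃SepCoPAx F 2 ∧ (θ.ZtUnity F 2 ∧ θ.SlotsNondegenerate₁₃Ax F 2) ∧
# θ.Admissible F 2` is LITERALLY the hypothesis of RR-2's ⁵→⁶→⁷ door `exists_k0SepCoPH_of_exists_k0SepCoP_ax` (`Node00/Record13SepCoPRInhabitedOfSepCoPChi`), whose conclusion
# is the body of K0ᴬ `Record13SepCoPHInhabitedAx` at `(F, 2)`

CITATION HEADER.  [III] = [Balaban1988Convergent] (CMP **119**) Thm 1 p.262, (2.7) p.255, (2.12) p.256, (2.18) p.257, (2.28) p.259, (3.16)–(3.22) pp.268–269; [IV] =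
[Balaban1989LargeFieldI] (0.3)–(0.4) p.176; [6] = [Balaban1985RegularSpaces] (1.3)–(1.9) pp.76–77; [15] = [Balaban1985Variational] (6)–(7) p.278; [I] = [Balaban1987RG1]
(0.21) p.256, (2.9) p.266.  Every declaration below is the VERBATIM body of the like-named declaration (minus the suffix `_chi` ∕ the token `Ax`) of
`Node00/Record13SepCoPLiveSelectorZ.lean` §1 (:47, :65) with EXACTLY the substitutions of [Ax-3b∕3c∕3d] ∕ F2∪F3 ∕ F6∪F7 ∕ node00-def-Y (b) `Node00/Record13NumericsOfThm1CCMZChi`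
(`theta13LiveOfNumericsZ … ↦ theta13LiveOfNumericsZChi … χ` ∕ `theta13LiveOfNumericsZAx …`, `Provisos₁₃SepCoP ↦ Provisos₁₃SepCoPChi … χ` ∕ `Provisos₁₃SepCoPAx`, `SlotsNondegenerate₁₃ ↦
SlotsNondegenerate₁₃Chi … χ` ∕ `SlotsNondegenerate₁₃Ax`, `gOfRecord₁₃ ↦ gOfRecord₁₃Chi … χ`, `PartCompat₁₃ ↦ PartCompat₁₃Chi … χ`, `settingOfRecord₁₃ ↦ settingOfRecord₁₃Chi … χ`,
`suppOfRecord₁₃P ↦ suppOfRecord₁₃PChi … χ`, `UbgOfRecord₁₃CoP ↦ UbgOfRecord₁₃CoPChi … χ`; in the RE-CENTRED instance the slot is the CLOSED FORM `chiFixed29Ax F 2 n.ν ε₂₉ =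
chiβOfRecord₁₃Ax (theta13LiveOfNumericsZAx …)` (def-Y (b) `chiβOfRecord₁₃Ax_theta13LiveOfNumericsZAx`, `rfl`)).  dag-n07-w3 g22's σ-closure table `SIGMA-CLOSURE-K0-V23-Ax.g22.md`
(4ca252f7ab47910a), row `Node00.Record13SepCoPLiveSelectorZ` (2): both typed here + the Ax instance.

Cell `pub-ymgap`, LADDER-YM R4 NODE 00, seat `pub-ymgap-node00-def-RR-2` g26.  `--kind definition --supports stmt-QuantumFields-27238` (K0ᴬ door supply;
count-neutral).  PURELY ADDITIVE: a NEW leaf; no source module edited (CRIT-1 g33 terms (α)).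

HONEST SCOPE.  REDUCTIONS: row Z by K0b's residual laws, row P12 hypothesis-free, row G by `n.Pos ∧ 0 < ε₂₉`, the core rows by (H-U) — and ROW P11 `bg` (the (7)-guarded
separated row at the Co carrier along partition-compatible runs) stays a DISPLAYED HYPOTHESIS `hbgSepCoP`: NOTHING of [III] ∕ [IV] ∕ [6] ∕ [15] ∕ [I] is asserted or
discharged; NO K0 body is inhabited outright — K0ᴬ `stmt-QuantumFields-27238` is NOT closed (door supply only: its closer owes `hbgSepCoP` AT THE RE-CENTRED WITNESS, def-Y (d)'s
`bg_numerics_of_letters_chi` lane and the Thm1CCM letters); counts unmoved (typed 28∕28 · discharged 8∕28 · K 1∕4).  One finite `𝕋⁴` family at fixed `ε` — the route closes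
the conditional finite-𝕋⁴ rung `BalabanLadder.UV` only; NOT continuum ∕ ℝ⁴ ∕ OS; the Yang–Mills mass gap (Clay) is NOT proved.  No `instance`, no `notation`, no `sorry`.
-/

noncomputable section

open MeasureTheory
open scoped Matrix.Norms.L2Operator

namespace Literature.MathematicalPhysics.QuantumFieldTheory.Balaban1983to89.Node00

open T4Continuum AveragingRT T4FiniteEpsInhabited B14.Eq218Concrete B15DeterminingSets B15RopTotal FlowStep FlowStepRuns DagBinding T4DatumAssembly

/-! ## §1. At the χ all-numerics family with the letters: `Provisos₁₃SepCoPChi` from the guarded row alone, and the ⁵-level K0 body generic in χ -/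

section AllNumericsSepCoPZChi

variable (F : T4Family) (N : ℕ) [NeZero N] (n : Stage12Numerics) (ε₂₉ : ℝ) (Efl logz : B12.RunParams → ℕ → ℝ) (χ : ChiSlot F N)

/-- **★ `Provisos₁₃SepCoPChi` AT EVERY MEMBER OF THE χ ALL-NUMERICS FAMILY WITH THE LETTERS CARRYING K0b's RESIDUALS, FROM THE (7)-GUARDED SEPARATED ROW AT THE χ-GENERIC Co
CARRIER THERE ALONE** (plus the two pins; F6∪F7's θ-generic `provisos₁₃SepCoP_liveRepin₁₃_of_bgSepCoP_chi` at the identity-selector member `theta13OfNumericsZ`, centre-free).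
[cite: Balaban1988Convergent, (2.18) p.257, (2.28) p.259, (3.16) p.268, (3.22) p.269; Balaban1985RegularSpaces, (1.3)–(1.9) p.77; Balaban1985Variational, (6)–(7) p.278; Balaban1989LargeFieldI, (0.3)–(0.4) p.176 (bookkeeping)] -/
theorem provisos₁₃SepCoP_theta13LiveOfNumericsZ_of_bgSepCoP_chi (hM : ∃ a : ℕ, n.τ9.M = F.L ^ a) (hM₁ : n.ν.M₁ ∣ n.τ9.M)
    (hbgSepCoP : ∀ (p : B12.RunParams) (m : ℕ), m ≤ p.K → Step.InInterval (theta13LiveOfNumericsZChi F N n ε₂₉ (zeta316OfRecord F N n.ν n.τ9.M n.A₁) (RzOfRecord F N) (ZtOfRecord F N) Efl logz χ).γ m (gOfRecord₁₃Chi F N (theta13LiveOfNumericsZChi F N n ε₂₉ (zeta316OfRecord F N n.ν n.τ9.M n.A₁) (RzOfRecord F N) (ZtOfRecord F N) Efl logz χ) χ p) → PartCompat₁₃Chi F N (theta13LiveOfNumericsZChi F N n ε₂₉ (zeta316OfRecord F N n.ν n.τ9.M n.A₁) (RzOfRecord F N) (ZtOfRecord F N) Efl logz χ) χ p m →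
      ∀ s : SeqOfRecord F (theta13LiveOfNumericsZChi F N n ε₂₉ (zeta316OfRecord F N n.ν n.τ9.M n.A₁) (RzOfRecord F N) (ZtOfRecord F N) Efl logz χ).ν (theta13LiveOfNumericsZChi F N n ε₂₉ (zeta316OfRecord F N n.ν n.τ9.M n.A₁) (RzOfRecord F N) (ZtOfRecord F N) Efl logz χ).τ9.M (gOfRecord₁₃Chi F N (theta13LiveOfNumericsZChi F N n ε₂₉ (zeta316OfRecord F N n.ν n.τ9.M n.A₁) (RzOfRecord F N) (ZtOfRecord F N) Efl logz χ) χ p) p.K m, Sect2.SeqSeparated (theta13LiveOfNumericsZChi F N n ε₂₉ (zeta316OfRecord F N n.ν n.τ9.M n.A₁) (RzOfRecord F N) (ZtOfRecord F N) Efl logz χ).ν.M₁ s →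
      ∀ W : MSField (F.P p.K) (SU N), W ∈ suppOfRecord₁₃PChi F N (theta13LiveOfNumericsZChi F N n ε₂₉ (zeta316OfRecord F N n.ν n.τ9.M n.A₁) (RzOfRecord F N) (ZtOfRecord F N) Efl logz χ) χ p m s →
      Sect2.DataSmall7PTop (avOfRecord F N p.K) s.Ω (suppDomOfRecord F (theta13LiveOfNumericsZChi F N n ε₂₉ (zeta316OfRecord F N n.ν n.τ9.M n.A₁) (RzOfRecord F N) (ZtOfRecord F N) Efl logz χ).ν p.K s.Ω) m (fun j => (theta13LiveOfNumericsZChi F N n ε₂₉ (zeta316OfRecord F N n.ν n.τ9.M n.A₁) (RzOfRecord F N) (ZtOfRecord F N) Efl logz χ).s2.cR * epsOfRecord (theta13LiveOfNumericsZChi F N n ε₂₉ (zeta316OfRecord F N n.ν n.τ9.M n.A₁) (RzOfRecord F N) (ZtOfRecord F N) Efl logz χ).ν (gOfRecord₁₃Chi F N (theta13LiveOfNumericsZChi F N n ε₂₉ (zeta316OfRecord F N n.ν n.τ9.M n.A₁) (RzOfRecord F N) (ZtOfRecord F N) Efl logz χ) χ p) j) W →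
      ∀ j, 1 ≤ j → j ≤ m → ∀ X : (Sect2.domSys (F.P p.K) (theta13LiveOfNumericsZChi F N n ε₂₉ (zeta316OfRecord F N n.ν n.τ9.M n.A₁) (RzOfRecord F N) (ZtOfRecord F N) Efl logz χ).τ9.M j).Dom,
      (Sect2.domSites (F.P p.K) (theta13LiveOfNumericsZChi F N n ε₂₉ (zeta316OfRecord F N n.ν n.τ9.M n.A₁) (RzOfRecord F N) (ZtOfRecord F N) Efl logz χ).τ9.M j X ⊆ s.Λ j →
        Sect2.ofBackgroundC (settingOfRecord₁₃Chi F N (theta13LiveOfNumericsZChi F N n ε₂₉ (zeta316OfRecord F N n.ν n.τ9.M n.A₁) (RzOfRecord F N) (ZtOfRecord F N) Efl logz χ) χ p).ι (UbgOfRecord₁₃CoPChi F N (theta13LiveOfNumericsZChi F N n ε₂₉ (zeta316OfRecord F N n.ν n.τ9.M n.A₁) (RzOfRecord F N) (ZtOfRecord F N) Efl logz χ) χ p m s W) ∈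
          Sect2.spaceI (settingOfRecord₁₃Chi F N (theta13LiveOfNumericsZChi F N n ε₂₉ (zeta316OfRecord F N n.ν n.τ9.M n.A₁) (RzOfRecord F N) (ZtOfRecord F N) Efl logz χ) χ p) ((theta13LiveOfNumericsZChi F N n ε₂₉ (zeta316OfRecord F N n.ν n.τ9.M n.A₁) (RzOfRecord F N) (ZtOfRecord F N) Efl logz χ).Rz p.K) (theta13LiveOfNumericsZChi F N n ε₂₉ (zeta316OfRecord F N n.ν n.τ9.M n.A₁) (RzOfRecord F N) (ZtOfRecord F N) Efl logz χ).τ9.M j (Sect2.domSites (F.P p.K) (theta13LiveOfNumericsZChi F N n ε₂₉ (zeta316OfRecord F N n.ν n.τ9.M n.A₁) (RzOfRecord F N) (ZtOfRecord F N) Efl logz χ).τ9.M j X)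
            ((settingOfRecord₁₃Chi F N (theta13LiveOfNumericsZChi F N n ε₂₉ (zeta316OfRecord F N n.ν n.τ9.M n.A₁) (RzOfRecord F N) (ZtOfRecord F N) Efl logz χ) χ p).lf.alpha0 ((settingOfRecord₁₃Chi F N (theta13LiveOfNumericsZChi F N n ε₂₉ (zeta316OfRecord F N n.ν n.τ9.M n.A₁) (RzOfRecord F N) (ZtOfRecord F N) Efl logz χ) χ p).flow.g j)) ((settingOfRecord₁₃Chi F N (theta13LiveOfNumericsZChi F N n ε₂₉ (zeta316OfRecord F N n.ν n.τ9.M n.A₁) (RzOfRecord F N) (ZtOfRecord F N) Efl logz χ) χ p).lf.alpha1 ((settingOfRecord₁₃Chi F N (theta13LiveOfNumericsZChi F N n ε₂₉ (zeta316OfRecord F N n.ν n.τ9.M n.A₁) (RzOfRecord F N) (ZtOfRecord F N) Efl logz χ) χ p).flow.g j))) ∧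
      (Sect2.admB (F.P p.K) (theta13LiveOfNumericsZChi F N n ε₂₉ (zeta316OfRecord F N n.ν n.τ9.M n.A₁) (RzOfRecord F N) (ZtOfRecord F N) Efl logz χ).ν (theta13LiveOfNumericsZChi F N n ε₂₉ (zeta316OfRecord F N n.ν n.τ9.M n.A₁) (RzOfRecord F N) (ZtOfRecord F N) Efl logz χ).τ9.M (gOfRecord₁₃Chi F N (theta13LiveOfNumericsZChi F N n ε₂₉ (zeta316OfRecord F N n.ν n.τ9.M n.A₁) (RzOfRecord F N) (ZtOfRecord F N) Efl logz χ) χ p) s.Ω s.Λ j (Sect2.domSites (F.P p.K) (theta13LiveOfNumericsZChi F N n ε₂₉ (zeta316OfRecord F N n.ν n.τ9.M n.A₁) (RzOfRecord F N) (ZtOfRecord F N) Efl logz χ).τ9.M j X) = true →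
        Sect2.ofBackgroundC (settingOfRecord₁₃Chi F N (theta13LiveOfNumericsZChi F N n ε₂₉ (zeta316OfRecord F N n.ν n.τ9.M n.A₁) (RzOfRecord F N) (ZtOfRecord F N) Efl logz χ) χ p).ι (UbgOfRecord₁₃CoPChi F N (theta13LiveOfNumericsZChi F N n ε₂₉ (zeta316OfRecord F N n.ν n.τ9.M n.A₁) (RzOfRecord F N) (ZtOfRecord F N) Efl logz χ) χ p m s W) ∈
          Sect2.spaceMS (settingOfRecord₁₃Chi F N (theta13LiveOfNumericsZChi F N n ε₂₉ (zeta316OfRecord F N n.ν n.τ9.M n.A₁) (RzOfRecord F N) (ZtOfRecord F N) Efl logz χ) χ p) ((theta13LiveOfNumericsZChi F N n ε₂₉ (zeta316OfRecord F N n.ν n.τ9.M n.A₁) (RzOfRecord F N) (ZtOfRecord F N) Efl logz χ).Rz p.K) (theta13LiveOfNumericsZChi F N n ε₂₉ (zeta316OfRecord F N n.ν n.τ9.M n.A₁) (RzOfRecord F N) (ZtOfRecord F N) Efl logz χ).τ9.M j (Sect2.domSites (F.P p.K) (theta13LiveOfNumericsZChi F N n ε₂₉ (zeta316OfRecord F N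 n.ν n.τ9.M n.A₁) (RzOfRecord F N) (ZtOfRecord F N) Efl logz χ).τ9.M j X) s.Ω)) :
    (theta13LiveOfNumericsZChi F N n ε₂₉ (zeta316OfRecord F N n.ν n.τ9.M n.A₁) (RzOfRecord F N) (ZtOfRecord F N) Efl logz χ).Provisos₁₃SepCoPChi F N χ :=
  (theta13OfNumericsZ F N n ε₂₉ _ _ _ Efl logz).provisos₁₃SepCoP_liveRepin₁₃_of_bgSepCoP_chi (hasResidualsOfRecord_theta13OfNumericsZ F N n ε₂₉ Efl logz) hM hM₁ hbgSepCoP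

/-- **★★★ THE ⁵-LEVEL K0 BODY FOR `F` AT `N = 2`, GENERIC IN A FIXED β-SLOT χ, AT ANY NUMERICS** from `n.Pos`, `0 < ε₂₉`, the two pins and THE (7)-GUARDED SEPARATED ROW P11
AT THE χ-GENERIC Co CARRIER there ALONE (row Z by K0b's residual laws, row P12 hypothesis-free — def-Y (b) `slotsNondegenerate₁₃_theta13LiveOfNumericsZ_of_hasResiduals_chi`, row G
by `admissible_theta13LiveOfNumericsZ_chi`).  A REDUCTION — NOT a discharge. [cite: Balaban1988Convergent, Thm 1 p.262, (2.7) p.255, (2.12) p.256, (2.28) p.259, (3.16)–(3.22) pp.268–269; Balaban1985RegularSpaces, (1.3)–(1.9) p.77; Balaban1985Variational, (6)–(7) p.278; Balaban1989LargeFieldI, (0.3)–(0.4) p.176 (bookkeeping)] -/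
theorem exists_k0SepCoP_of_bgSepCoP_theta13LiveOfNumericsZ_chi (F : T4Family) {n : Stage12Numerics} {ε₂₉ : ℝ} {Efl logz : B12.RunParams → ℕ → ℝ} (χ : ChiSlot F 2)
    (hn : n.Pos) (hε' : 0 < ε₂₉) (hM : ∃ a : ℕ, n.τ9.M = F.L ^ a) (hM₁ : n.ν.M₁ ∣ n.τ9.M)
    (hbgSepCoP : ∀ (p : B12.RunParams) (m : ℕ), m ≤ p.K → Step.InInterval (theta13LiveOfNumericsZChi F 2 n ε₂₉ (zeta316OfRecord F 2 n.ν n.τ9.M n.A₁) (RzOfRecord F 2) (ZtOfRecord F 2) Efl logz χ).γ m (gOfRecord₁₃Chi F 2 (theta13LiveOfNumericsZChi F 2 n ε₂₉ (zeta316OfRecord F 2 n.ν n.τ9.M n.A₁) (RzOfRecord F 2) (ZtOfRecord F 2) Efl logz χ) χ p) → PartCompat₁₃Chi F 2 (theta13LiveOfNumericsZChi F 2 n ε₂₉ (zeta316OfRecord F 2 n.ν n.τ9.M n.A₁) (RzOfRecord F 2) (ZtOfRecord F 2) Efl logz χ) χ p m →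
      ∀ s : SeqOfRecord F (theta13LiveOfNumericsZChi F 2 n ε₂₉ (zeta316OfRecord F 2 n.ν n.τ9.M n.A₁) (RzOfRecord F 2) (ZtOfRecord F 2) Efl logz χ).ν (theta13LiveOfNumericsZChi F 2 n ε₂₉ (zeta316OfRecord F 2 n.ν n.τ9.M n.A₁) (RzOfRecord F 2) (ZtOfRecord F 2) Efl logz χ).τ9.M (gOfRecord₁₃Chi F 2 (theta13LiveOfNumericsZChi F 2 n ε₂₉ (zeta316OfRecord F 2 n.ν n.τ9.M n.A₁) (RzOfRecord F 2) (ZtOfRecord F 2) Efl logz χ) χ p) p.K m, Sect2.SeqSeparated (theta13LiveOfNumericsZChi F 2 n ε₂₉ (zeta316OfRecord F 2 n.ν n.τ9.M n.A₁) (RzOfRecord F 2) (ZtOfRecord F 2) Efl logz χ).ν.M₁ s →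
      ∀ W : MSField (F.P p.K) (SU 2), W ∈ suppOfRecord₁₃PChi F 2 (theta13LiveOfNumericsZChi F 2 n ε₂₉ (zeta316OfRecord F 2 n.ν n.τ9.M n.A₁) (RzOfRecord F 2) (ZtOfRecord F 2) Efl logz χ) χ p m s →
      Sect2.DataSmall7PTop (avOfRecord F 2 p.K) s.Ω (suppDomOfRecord F (theta13LiveOfNumericsZChi F 2 n ε₂₉ (zeta316OfRecord F 2 n.ν n.τ9.M n.A₁) (RzOfRecord F 2) (ZtOfRecord F 2) Efl logz χ).ν p.K s.Ω) m (fun j => (theta13LiveOfNumericsZChi F 2 n ε₂₉ (zeta316OfRecord F 2 n.ν n.τ9.M n.A₁) (RzOfRecord F 2) (ZtOfRecord F 2) Efl logz χ).s2.cR * epsOfRecord (theta13LiveOfNumericsZChi F 2 n ε₂₉ (zeta316OfRecord F 2 n.ν n.τ9.M n.A₁) (RzOfRecord F 2) (ZtOfRecord F 2) Efl logz χ).ν (gOfRecord₁₃Chi F 2 (theta13LiveOfNumericsZChi F 2 n ε₂₉ (zeta316OfRecord F 2 n.ν n.τ9.M n.A₁) (RzOfRecord F 2) (ZtOfRecord F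 2) Efl logz χ) χ p) j) W →
      ∀ j, 1 ≤ j → j ≤ m → ∀ X : (Sect2.domSys (F.P p.K) (theta13LiveOfNumericsZChi F 2 n ε₂₉ (zeta316OfRecord F 2 n.ν n.τ9.M n.A₁) (RzOfRecord F 2) (ZtOfRecord F 2) Efl logz χ).τ9.M j).Dom,
      (Sect2.domSites (F.P p.K) (theta13LiveOfNumericsZChi F 2 n ε₂₉ (zeta316OfRecord F 2 n.ν n.τ9.M n.A₁) (RzOfRecord F 2) (ZtOfRecord F 2) Efl logz χ).τ9.M j X ⊆ s.Λ j →
        Sect2.ofBackgroundC (settingOfRecord₁₃Chi F 2 (theta13LiveOfNumericsZChi F 2 n ε₂₉ (zeta316OfRecord F 2 n.ν n.τ9.M n.A₁) (RzOfRecord F 2) (ZtOfRecord F 2) Efl logz χ) χ p).ι (UbgOfRecord₁₃CoPChi F 2 (theta13LiveOfNumericsZChi F 2 n ε₂₉ (zeta316OfRecord F 2 n.ν n.τ9.M n.A₁) (RzOfRecord F 2) (ZtOfRecord F 2) Efl logz χ) χ p m s W) ∈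
          Sect2.spaceI (settingOfRecord₁₃Chi F 2 (theta13LiveOfNumericsZChi F 2 n ε₂₉ (zeta316OfRecord F 2 n.ν n.τ9.M n.A₁) (RzOfRecord F 2) (ZtOfRecord F 2) Efl logz χ) χ p) ((theta13LiveOfNumericsZChi F 2 n ε₂₉ (zeta316OfRecord F 2 n.ν n.τ9.M n.A₁) (RzOfRecord F 2) (ZtOfRecord F 2) Efl logz χ).Rz p.K) (theta13LiveOfNumericsZChi F 2 n ε₂₉ (zeta316OfRecord F 2 n.ν n.τ9.M n.A₁) (RzOfRecord F 2) (ZtOfRecord F 2) Efl logz χ).τ9.M j (Sect2.domSites (F.P p.K) (theta13LiveOfNumericsZChi F 2 n ε₂₉ (zeta316OfRecord F 2 n.ν n.τ9.M n.A₁) (RzOfRecord F 2) (ZtOfRecord F 2) Efl logz χ).τ9.M j X)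
            ((settingOfRecord₁₃Chi F 2 (theta13LiveOfNumericsZChi F 2 n ε₂₉ (zeta316OfRecord F 2 n.ν n.τ9.M n.A₁) (RzOfRecord F 2) (ZtOfRecord F 2) Efl logz χ) χ p).lf.alpha0 ((settingOfRecord₁₃Chi F 2 (theta13LiveOfNumericsZChi F 2 n ε₂₉ (zeta316OfRecord F 2 n.ν n.τ9.M n.A₁) (RzOfRecord F 2) (ZtOfRecord F 2) Efl logz χ) χ p).flow.g j)) ((settingOfRecord₁₃Chi F 2 (theta13LiveOfNumericsZChi F 2 n ε₂₉ (zeta316OfRecord F 2 n.ν n.τ9.M n.A₁) (RzOfRecord F 2) (ZtOfRecord F 2) Efl logz χ) χ p).lf.alpha1 ((settingOfRecord₁₃Chi F 2 (theta13LiveOfNumericsZChi F 2 n ε₂₉ (zeta316OfRecord F 2 n.ν n.τ9.M n.A₁) (RzOfRecord F 2) (ZtOfRecord F 2) Efl logz χ) χ p).flow.g j))) ∧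
      (Sect2.admB (F.P p.K) (theta13LiveOfNumericsZChi F 2 n ε₂₉ (zeta316OfRecord F 2 n.ν n.τ9.M n.A₁) (RzOfRecord F 2) (ZtOfRecord F 2) Efl logz χ).ν (theta13LiveOfNumericsZChi F 2 n ε₂₉ (zeta316OfRecord F 2 n.ν n.τ9.M n.A₁) (RzOfRecord F 2) (ZtOfRecord F 2) Efl logz χ).τ9.M (gOfRecord₁₃Chi F 2 (theta13LiveOfNumericsZChi F 2 n ε₂₉ (zeta316OfRecord F 2 n.ν n.τ9.M n.A₁) (RzOfRecord F 2) (ZtOfRecord F 2) Efl logz χ) χ p) s.Ω s.Λ j (Sect2.domSites (F.P p.K) (theta13LiveOfNumericsZChi F 2 n ε₂₉ (zeta316OfRecord F 2 n.ν n.τ9.M n.A₁) (RzOfRecord F 2) (ZtOfRecord F 2) Efl logz χ).τ9.M j X) = true →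
        Sect2.ofBackgroundC (settingOfRecord₁₃Chi F 2 (theta13LiveOfNumericsZChi F 2 n ε₂₉ (zeta316OfRecord F 2 n.ν n.τ9.M n.A₁) (RzOfRecord F 2) (ZtOfRecord F 2) Efl logz χ) χ p).ι (UbgOfRecord₁₃CoPChi F 2 (theta13LiveOfNumericsZChi F 2 n ε₂₉ (zeta316OfRecord F 2 n.ν n.τ9.M n.A₁) (RzOfRecord F 2) (ZtOfRecord F 2) Efl logz χ) χ p m s W) ∈
          Sect2.spaceMS (settingOfRecord₁₃Chi F 2 (theta13LiveOfNumericsZChi F 2 n ε₂₉ (zeta316OfRecord F 2 n.ν n.τ9.M n.A₁) (RzOfRecord F 2) (ZtOfRecord F 2) Efl logz χ) χ p) ((theta13LiveOfNumericsZChi F 2 n ε₂₉ (zeta316OfRecord F 2 n.ν n.τ9.M n.A₁) (RzOfRecord F 2) (ZtOfRecord F 2) Efl logz χ).Rz p.K) (theta13LiveOfNumericsZChi F 2 n ε₂₉ (zeta316OfRecord F 2 n.ν n.τ9.M n.A₁) (RzOfRecord F 2) (ZtOfRecord F 2) Efl logz χ).τ9.M j (Sect2.domSites (F.P p.K) (theta13LiveOfNumericsZChi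 F 2 n ε₂₉ (zeta316OfRecord F 2 n.ν n.τ9.M n.A₁) (RzOfRecord F 2) (ZtOfRecord F 2) Efl logz χ).τ9.M j X) s.Ω)) :
    ∃ θ : Stage13Params F 2, θ.Provisos₁₃SepCoPChi F 2 χ ∧ (θ.ZtUnity F 2 ∧ θ.SlotsNondegenerate₁₃Chi F 2 χ) ∧ θ.Admissible F 2 :=
  ⟨_, provisos₁₃SepCoP_theta13LiveOfNumericsZ_of_bgSepCoP_chi F 2 n ε₂₉ Efl logz χ hM hM₁ hbgSepCoP,
    ⟨ztUnity_theta13LiveOfNumericsZ_chi F 2 n ε₂₉ Efl logz χ, slotsNondegenerate₁₃_theta13LiveOfNumericsZ_of_hasResiduals_chi F 2 n ε₂₉ Efl logz χ⟩,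
    admissible_theta13LiveOfNumericsZ_chi F 2 _ _ _ Efl logz χ hn hε'⟩

end AllNumericsSepCoPZChi

/-! ## §2. ★★★ THE ⁵ SOCKET OF THE K0ᴬ ROAD — the RE-CENTRED instance at `theta13LiveOfNumericsZAx` (β-slot in closed form `chiFixed29Ax F 2 n.ν ε₂₉`) -/

section Ax

/-- **★★★ THE ⁵ SOCKET, RE-CENTRED — THE ⁵-LEVEL K0ᴬ-ROAD BODY FOR `F` AT `N = 2` AT ANY NUMERICS** from `n.Pos`, `0 < ε₂₉`, the two pins and THE (7)-GUARDED SEPARATED ROW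
P11 AT THE RE-CENTRED Co CARRIER OF THE RE-CENTRED WITNESS `theta13LiveOfNumericsZAx …` ALONE: the witness's own `…Ax` rows ARE the χ rows at `chiFixed29Ax F 2 n.ν ε₂₉`
(def-Y (b) `chiβOfRecord₁₃Ax_theta13LiveOfNumericsZAx`, `rfl`), so §1 applies verbatim.  Its conclusion is LITERALLY the hypothesis of RR-2's door
`exists_k0SepCoPH_of_exists_k0SepCoP_ax` — composing the two gives the K0ᴬ body FROM `hbgSepCoP` at the re-centred witness.  A REDUCTION — NOT a discharge; K0ᴬ NOT closed here.
[cite: Balaban1988Convergent, Thm 1 p.262, (2.7) p.255, (2.12) p.256, (2.28) p.259, (3.16)–(3.22) pp.268–269; Balaban1987RG1, (2.9) p.266; Balaban1985RegularSpaces, (1.3)–(1.9) p.77; Balaban1985Variational, (6)–(7) p.278; Balaban1989LargeFieldI, (0.3)–(0.4) p.176 (bookkeeping)] -/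
theorem exists_k0SepCoP_of_bgSepCoP_theta13LiveOfNumericsZAx (F : T4Family) {n : Stage12Numerics} {ε₂₉ : ℝ} {Efl logz : B12.RunParams → ℕ → ℝ}
    (hn : n.Pos) (hε' : 0 < ε₂₉) (hM : ∃ a : ℕ, n.τ9.M = F.L ^ a) (hM₁ : n.ν.M₁ ∣ n.τ9.M)
    (hbgSepCoP : ∀ (p : B12.RunParams) (m : ℕ), m ≤ p.K → Step.InInterval (theta13LiveOfNumericsZAx F 2 n ε₂₉ (zeta316OfRecord F 2 n.ν n.τ9.M n.A₁) (RzOfRecord F 2) (ZtOfRecord F 2) Efl logz).γ m (gOfRecord₁₃Chi F 2 (theta13LiveOfNumericsZAx F 2 n ε₂₉ (zeta316OfRecord F 2 n.ν n.τ9.M n.A₁) (RzOfRecord F 2) (ZtOfRecord F 2) Efl logz) (chiFixed29Ax F 2 n.ν ε₂₉) p) → PartCompat₁₃Chi F 2 (theta13LiveOfNumericsZAx F 2 n ε₂₉ (zeta316OfRecord F 2 n.ν n.τ9.M n.A₁) (RzOfRecord F 2) (ZtOfRecord F 2) Efl logz) (chiFixed29Ax F 2 n.ν ε₂₉) p m 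→
      ∀ s : SeqOfRecord F (theta13LiveOfNumericsZAx F 2 n ε₂₉ (zeta316OfRecord F 2 n.ν n.τ9.M n.A₁) (RzOfRecord F 2) (ZtOfRecord F 2) Efl logz).ν (theta13LiveOfNumericsZAx F 2 n ε₂₉ (zeta316OfRecord F 2 n.ν n.τ9.M n.A₁) (RzOfRecord F 2) (ZtOfRecord F 2) Efl logz).τ9.M (gOfRecord₁₃Chi F 2 (theta13LiveOfNumericsZAx F 2 n ε₂₉ (zeta316OfRecord F 2 n.ν n.τ9.M n.A₁) (RzOfRecord F 2) (ZtOfRecord F 2) Efl logz) (chiFixed29Ax F 2 n.ν ε₂₉) p) p.K m, Sect2.SeqSeparated (theta13LiveOfNumericsZAx F 2 n ε₂₉ (zeta316OfRecord F 2 n.ν n.τ9.M n.A₁) (RzOfRecord F 2) (ZtOfRecord F 2) Efl logz).ν.M₁ s →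
      ∀ W : MSField (F.P p.K) (SU 2), W ∈ suppOfRecord₁₃PChi F 2 (theta13LiveOfNumericsZAx F 2 n ε₂₉ (zeta316OfRecord F 2 n.ν n.τ9.M n.A₁) (RzOfRecord F 2) (ZtOfRecord F 2) Efl logz) (chiFixed29Ax F 2 n.ν ε₂₉) p m s →
      Sect2.DataSmall7PTop (avOfRecord F 2 p.K) s.Ω (suppDomOfRecord F (theta13LiveOfNumericsZAx F 2 n ε₂₉ (zeta316OfRecord F 2 n.ν n.τ9.M n.A₁) (RzOfRecord F 2) (ZtOfRecord F 2) Efl logz).ν p.K s.Ω) m (fun j => (theta13LiveOfNumericsZAx F 2 n ε₂₉ (zeta316OfRecord F 2 n.ν n.τ9.M n.A₁) (RzOfRecord F 2) (ZtOfRecord F 2) Efl logz).s2.cR * epsOfRecord (theta13LiveOfNumericsZAx F 2 n ε₂₉ (zeta316OfRecord F 2 n.ν n.τ9.M n.A₁) (RzOfRecord F 2) (ZtOfRecord F 2) Efl logz).ν (gOfRecord₁₃Chi F 2 (theta13LiveOfNumericsZAx F 2 n ε₂₉ (zeta316OfRecord F 2 n.ν n.τ9.M n.A₁) (RzOfRecord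 F 2) (ZtOfRecord F 2) Efl logz) (chiFixed29Ax F 2 n.ν ε₂₉) p) j) W →
      ∀ j, 1 ≤ j → j ≤ m → ∀ X : (Sect2.domSys (F.P p.K) (theta13LiveOfNumericsZAx F 2 n ε₂₉ (zeta316OfRecord F 2 n.ν n.τ9.M n.A₁) (RzOfRecord F 2) (ZtOfRecord F 2) Efl logz).τ9.M j).Dom,
      (Sect2.domSites (F.P p.K) (theta13LiveOfNumericsZAx F 2 n ε₂₉ (zeta316OfRecord F 2 n.ν n.τ9.M n.A₁) (RzOfRecord F 2) (ZtOfRecord F 2) Efl logz).τ9.M j X ⊆ s.Λ j →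
        Sect2.ofBackgroundC (settingOfRecord₁₃Chi F 2 (theta13LiveOfNumericsZAx F 2 n ε₂₉ (zeta316OfRecord F 2 n.ν n.τ9.M n.A₁) (RzOfRecord F 2) (ZtOfRecord F 2) Efl logz) (chiFixed29Ax F 2 n.ν ε₂₉) p).ι (UbgOfRecord₁₃CoPChi F 2 (theta13LiveOfNumericsZAx F 2 n ε₂₉ (zeta316OfRecord F 2 n.ν n.τ9.M n.A₁) (RzOfRecord F 2) (ZtOfRecord F 2) Efl logz) (chiFixed29Ax F 2 n.ν ε₂₉) p m s W) ∈
          Sect2.spaceI (settingOfRecord₁₃Chi F 2 (theta13LiveOfNumericsZAx F 2 n ε₂₉ (zeta316OfRecord F 2 n.ν n.τ9.M n.A₁) (RzOfRecord F 2) (ZtOfRecord F 2) Efl logz) (chiFixed29Ax F 2 n.ν ε₂₉) p) ((theta13LiveOfNumericsZAx F 2 n ε₂₉ (zeta316OfRecord F 2 n.ν n.τ9.M n.A₁) (RzOfRecord F 2) (ZtOfRecord F 2) Efl logz).Rz p.K) (theta13LiveOfNumericsZAx F 2 n ε₂₉ (zeta316OfRecord F 2 n.ν n.τ9.M n.A₁)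 (RzOfRecord F 2) (ZtOfRecord F 2) Efl logz).τ9.M j (Sect2.domSites (F.P p.K) (theta13LiveOfNumericsZAx F 2 n ε₂₉ (zeta316OfRecord F 2 n.ν n.τ9.M n.A₁) (RzOfRecord F 2) (ZtOfRecord F 2) Efl logz).τ9.M j X)
            ((settingOfRecord₁₃Chi F 2 (theta13LiveOfNumericsZAx F 2 n ε₂₉ (zeta316OfRecord F 2 n.ν n.τ9.M n.A₁) (RzOfRecord F 2) (ZtOfRecord F 2) Efl logz) (chiFixed29Ax F 2 n.ν ε₂₉) p).lf.alpha0 ((settingOfRecord₁₃Chi F 2 (theta13LiveOfNumericsZAx F 2 n ε₂₉ (zeta316OfRecord F 2 n.ν n.τ9.M n.A₁) (RzOfRecord F 2) (ZtOfRecord F 2) Efl logz) (chiFixed29Ax F 2 n.ν ε₂₉) p).flow.g j)) ((settingOfRecord₁₃Chi F 2 (theta13LiveOfNumericsZAx F 2 n ε₂₉ (zeta316OfRecord F 2 n.ν n.τ9.M n.A₁) (RzOfRecord F 2) (ZtOfRecord F 2) Efl logz) (chiFixed29Ax F 2 n.ν ε₂₉) p).lf.alpha1 ((settingOfRecord₁₃Chi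 F 2 (theta13LiveOfNumericsZAx F 2 n ε₂₉ (zeta316OfRecord F 2 n.ν n.τ9.M n.A₁) (RzOfRecord F 2) (ZtOfRecord F 2) Efl logz) (chiFixed29Ax F 2 n.ν ε₂₉) p).flow.g j))) ∧
      (Sect2.admB (F.P p.K) (theta13LiveOfNumericsZAx F 2 n ε₂₉ (zeta316OfRecord F 2 n.ν n.τ9.M n.A₁) (RzOfRecord F 2) (ZtOfRecord F 2) Efl logz).ν (theta13LiveOfNumericsZAx F 2 n ε₂₉ (zeta316OfRecord F 2 n.ν n.τ9.M n.A₁) (RzOfRecord F 2) (ZtOfRecord F 2) Efl logz).τ9.M (gOfRecord₁₃Chi F 2 (theta13LiveOfNumericsZAx F 2 n ε₂₉ (zeta316OfRecord F 2 n.ν n.τ9.M n.A₁) (RzOfRecord F 2) (ZtOfRecord F 2) Efl logz) (chiFixed29Ax F 2 n.ν ε₂₉) p) s.Ω s.Λ j (Sect2.domSites (F.P p.K) (theta13LiveOfNumericsZAx F 2 n ε₂₉ (zeta316OfRecord F 2 n.ν n.τ9.M n.A₁) (RzOfRecord F 2) (ZtOfRecord F 2) Efl logz).τ9.M j X) = true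 →
        Sect2.ofBackgroundC (settingOfRecord₁₃Chi F 2 (theta13LiveOfNumericsZAx F 2 n ε₂₉ (zeta316OfRecord F 2 n.ν n.τ9.M n.A₁) (RzOfRecord F 2) (ZtOfRecord F 2) Efl logz) (chiFixed29Ax F 2 n.ν ε₂₉) p).ι (UbgOfRecord₁₃CoPChi F 2 (theta13LiveOfNumericsZAx F 2 n ε₂₉ (zeta316OfRecord F 2 n.ν n.τ9.M n.A₁) (RzOfRecord F 2) (ZtOfRecord F 2) Efl logz) (chiFixed29Ax F 2 n.ν ε₂₉) p m s W) ∈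
          Sect2.spaceMS (settingOfRecord₁₃Chi F 2 (theta13LiveOfNumericsZAx F 2 n ε₂₉ (zeta316OfRecord F 2 n.ν n.τ9.M n.A₁) (RzOfRecord F 2) (ZtOfRecord F 2) Efl logz) (chiFixed29Ax F 2 n.ν ε₂₉) p) ((theta13LiveOfNumericsZAx F 2 n ε₂₉ (zeta316OfRecord F 2 n.ν n.τ9.M n.A₁) (RzOfRecord F 2) (ZtOfRecord F 2) Efl logz).Rz p.K) (theta13LiveOfNumericsZAx F 2 n ε₂₉ (zeta316OfRecord F 2 n.ν n.τ9.M n.A₁) (RzOfRecord F 2) (ZtOfRecord F 2) Efl logz).τ9.M j (Sect2.domSites (F.P p.K) (theta13LiveOfNumericsZAx F 2 n ε₂₉ (zeta316OfRecord F 2 n.ν n.τ9.M n.A₁) (RzOfRecord F 2) (ZtOfRecord F 2) Efl logz).τ9.M j X) s.Ω)) :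
    ∃ θ : Stage13Params F 2, θ.Provisos₁₃SepCoPAx F 2 ∧ (θ.ZtUnity F 2 ∧ θ.SlotsNondegenerate₁₃Ax F 2) ∧ θ.Admissible F 2 :=
  ⟨theta13LiveOfNumericsZAx F 2 n ε₂₉ (zeta316OfRecord F 2 n.ν n.τ9.M n.A₁) (RzOfRecord F 2) (ZtOfRecord F 2) Efl logz,
    provisos₁₃SepCoP_theta13LiveOfNumericsZ_of_bgSepCoP_chi F 2 n ε₂₉ Efl logz (chiFixed29Ax F 2 n.ν ε₂₉) hM hM₁ hbgSepCoP,
    ⟨ztUnity_theta13LiveOfNumericsZ_chi F 2 n ε₂₉ Efl logz (chiFixed29Ax F 2 n.ν ε₂₉),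
      slotsNondegenerate₁₃_theta13LiveOfNumericsZ_of_hasResiduals_chi F 2 n ε₂₉ Efl logz (chiFixed29Ax F 2 n.ν ε₂₉)⟩,
    admissible_theta13LiveOfNumericsZ_chi F 2 _ _ _ Efl logz (chiFixed29Ax F 2 n.ν ε₂₉) hn hε'⟩

/-- **★★★ THE K0ᴬ BODY AT `(F, 2)` FROM ROW P11 AT THE RE-CENTRED WITNESS ALONE — THE WHOLE RE-CENTRED K0 ROAD ⁵→⁶→⁷ IN ONE TERM** (§2's socket composed with RR-2's door
`exists_k0SepCoPH_of_exists_k0SepCoP_ax`): CONDITIONAL on `hbgSepCoP` (row P11, DISPLAYED) and the pins; its conclusion is LITERALLY the `F`-instance of K0ᴬ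
`Record13SepCoPHInhabitedAx`'s body.  K0ᴬ is NOT closed here (the hypothesis is owed). [cite: Balaban1988Convergent, Thm 1 p.262, (1.11) p.248, (2.21) p.258, (2.28) p.259, (3.16)–(3.23) pp.268–270; Balaban1989LargeFieldI, (0.2)–(0.4) p.176 (bookkeeping)] -/
theorem exists_k0SepCoPH_of_bgSepCoP_theta13LiveOfNumericsZAx (F : T4Family) {n : Stage12Numerics} {ε₂₉ : ℝ} {Efl logz : B12.RunParams → ℕ → ℝ}
    (hn : n.Pos) (hε' : 0 < ε₂₉) (hM : ∃ a : ℕ, n.τ9.M = F.L ^ a) (hM₁ : n.ν.M₁ ∣ n.τ9.M)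
    (hbgSepCoP : ∀ (p : B12.RunParams) (m : ℕ), m ≤ p.K → Step.InInterval (theta13LiveOfNumericsZAx F 2 n ε₂₉ (zeta316OfRecord F 2 n.ν n.τ9.M n.A₁) (RzOfRecord F 2) (ZtOfRecord F 2) Efl logz).γ m (gOfRecord₁₃Chi F 2 (theta13LiveOfNumericsZAx F 2 n ε₂₉ (zeta316OfRecord F 2 n.ν n.τ9.M n.A₁) (RzOfRecord F 2) (ZtOfRecord F 2) Efl logz) (chiFixed29Ax F 2 n.ν ε₂₉) p) → PartCompat₁₃Chi F 2 (theta13LiveOfNumericsZAx F 2 n ε₂₉ (zeta316OfRecord F 2 n.ν n.τ9.M n.A₁) (RzOfRecord F 2) (ZtOfRecord F 2) Efl logz) (chiFixed29Ax F 2 n.ν ε₂₉) p m →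
      ∀ s : SeqOfRecord F (theta13LiveOfNumericsZAx F 2 n ε₂₉ (zeta316OfRecord F 2 n.ν n.τ9.M n.A₁) (RzOfRecord F 2) (ZtOfRecord F 2) Efl logz).ν (theta13LiveOfNumericsZAx F 2 n ε₂₉ (zeta316OfRecord F 2 n.ν n.τ9.M n.A₁) (RzOfRecord F 2) (ZtOfRecord F 2) Efl logz).τ9.M (gOfRecord₁₃Chi F 2 (theta13LiveOfNumericsZAx F 2 n ε₂₉ (zeta316OfRecord F 2 n.ν n.τ9.M n.A₁) (RzOfRecord F 2) (ZtOfRecord F 2) Efl logz) (chiFixed29Ax F 2 n.ν ε₂₉) p) p.K m, Sect2.SeqSeparated (theta13LiveOfNumericsZAx F 2 n ε₂₉ (zeta316OfRecord F 2 n.ν n.τ9.M n.A₁) (RzOfRecord F 2) (ZtOfRecord F 2) Efl logz).ν.M₁ s →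
      ∀ W : MSField (F.P p.K) (SU 2), W ∈ suppOfRecord₁₃PChi F 2 (theta13LiveOfNumericsZAx F 2 n ε₂₉ (zeta316OfRecord F 2 n.ν n.τ9.M n.A₁) (RzOfRecord F 2) (ZtOfRecord F 2) Efl logz) (chiFixed29Ax F 2 n.ν ε₂₉) p m s →
      Sect2.DataSmall7PTop (avOfRecord F 2 p.K) s.Ω (suppDomOfRecord F (theta13LiveOfNumericsZAx F 2 n ε₂₉ (zeta316OfRecord F 2 n.ν n.τ9.M n.A₁) (RzOfRecord F 2) (ZtOfRecord F 2) Efl logz).ν p.K s.Ω) m (fun j => (theta13LiveOfNumericsZAx F 2 n ε₂₉ (zeta316OfRecord F 2 n.ν n.τ9.M n.A₁) (RzOfRecord F 2) (ZtOfRecord F 2) Efl logz).s2.cR * epsOfRecord (theta13LiveOfNumericsZAx F 2 n ε₂₉ (zeta316OfRecord F 2 n.ν n.τ9.M n.A₁) (RzOfRecord F 2) (ZtOfRecord F 2) Efl logz).ν (gOfRecord₁₃Chi F 2 (theta13LiveOfNumericsZAx F 2 n ε₂₉ (zeta316OfRecord F 2 n.ν n.τ9.M n.A₁) (RzOfRecord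 F 2) (ZtOfRecord F 2) Efl logz) (chiFixed29Ax F 2 n.ν ε₂₉) p) j) W →
      ∀ j, 1 ≤ j → j ≤ m → ∀ X : (Sect2.domSys (F.P p.K) (theta13LiveOfNumericsZAx F 2 n ε₂₉ (zeta316OfRecord F 2 n.ν n.τ9.M n.A₁) (RzOfRecord F 2) (ZtOfRecord F 2) Efl logz).τ9.M j).Dom,
      (Sect2.domSites (F.P p.K) (theta13LiveOfNumericsZAx F 2 n ε₂₉ (zeta316OfRecord F 2 n.ν n.τ9.M n.A₁) (RzOfRecord F 2) (ZtOfRecord F 2) Efl logz).τ9.M j X ⊆ s.Λ j →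
        Sect2.ofBackgroundC (settingOfRecord₁₃Chi F 2 (theta13LiveOfNumericsZAx F 2 n ε₂₉ (zeta316OfRecord F 2 n.ν n.τ9.M n.A₁) (RzOfRecord F 2) (ZtOfRecord F 2) Efl logz) (chiFixed29Ax F 2 n.ν ε₂₉) p).ι (UbgOfRecord₁₃CoPChi F 2 (theta13LiveOfNumericsZAx F 2 n ε₂₉ (zeta316OfRecord F 2 n.ν n.τ9.M n.A₁) (RzOfRecord F 2) (ZtOfRecord F 2) Efl logz) (chiFixed29Ax F 2 n.ν ε₂₉) p m s W) ∈
          Sect2.spaceI (settingOfRecord₁₃Chi F 2 (theta13LiveOfNumericsZAx F 2 n ε₂₉ (zeta316OfRecord F 2 n.ν n.τ9.M n.A₁) (RzOfRecord F 2) (ZtOfRecord F 2) Efl logz) (chiFixed29Ax F 2 n.ν ε₂₉) p) ((theta13LiveOfNumericsZAx F 2 n ε₂₉ (zeta316OfRecord F 2 n.ν n.τ9.M n.A₁) (RzOfRecord F 2) (ZtOfRecord F 2) Efl logz).Rz p.K) (theta13LiveOfNumericsZAx F 2 n ε₂₉ (zeta316OfRecord F 2 n.ν n.τ9.M n.A₁)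 (RzOfRecord F 2) (ZtOfRecord F 2) Efl logz).τ9.M j (Sect2.domSites (F.P p.K) (theta13LiveOfNumericsZAx F 2 n ε₂₉ (zeta316OfRecord F 2 n.ν n.τ9.M n.A₁) (RzOfRecord F 2) (ZtOfRecord F 2) Efl logz).τ9.M j X)
            ((settingOfRecord₁₃Chi F 2 (theta13LiveOfNumericsZAx F 2 n ε₂₉ (zeta316OfRecord F 2 n.ν n.τ9.M n.A₁) (RzOfRecord F 2) (ZtOfRecord F 2) Efl logz) (chiFixed29Ax F 2 n.ν ε₂₉) p).lf.alpha0 ((settingOfRecord₁₃Chi F 2 (theta13LiveOfNumericsZAx F 2 n ε₂₉ (zeta316OfRecord F 2 n.ν n.τ9.M n.A₁) (RzOfRecord F 2) (ZtOfRecord F 2) Efl logz) (chiFixed29Ax F 2 n.ν ε₂₉) p).flow.g j)) ((settingOfRecord₁₃Chi F 2 (theta13LiveOfNumericsZAx F 2 n ε₂₉ (zeta316OfRecord F 2 n.ν n.τ9.M n.A₁) (RzOfRecord F 2) (ZtOfRecord F 2) Efl logz) (chiFixed29Ax F 2 n.ν ε₂₉) p).lf.alpha1 ((settingOfRecord₁₃Chi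 F 2 (theta13LiveOfNumericsZAx F 2 n ε₂₉ (zeta316OfRecord F 2 n.ν n.τ9.M n.A₁) (RzOfRecord F 2) (ZtOfRecord F 2) Efl logz) (chiFixed29Ax F 2 n.ν ε₂₉) p).flow.g j))) ∧
      (Sect2.admB (F.P p.K) (theta13LiveOfNumericsZAx F 2 n ε₂₉ (zeta316OfRecord F 2 n.ν n.τ9.M n.A₁) (RzOfRecord F 2) (ZtOfRecord F 2) Efl logz).ν (theta13LiveOfNumericsZAx F 2 n ε₂₉ (zeta316OfRecord F 2 n.ν n.τ9.M n.A₁) (RzOfRecord F 2) (ZtOfRecord F 2) Efl logz).τ9.M (gOfRecord₁₃Chi F 2 (theta13LiveOfNumericsZAx F 2 n ε₂₉ (zeta316OfRecord F 2 n.ν n.τ9.M n.A₁) (RzOfRecord F 2) (ZtOfRecord F 2) Efl logz) (chiFixed29Ax F 2 n.ν ε₂₉) p) s.Ω s.Λ j (Sect2.domSites (F.P p.K) (theta13LiveOfNumericsZAx F 2 n ε₂₉ (zeta316OfRecord F 2 n.ν n.τ9.M n.A₁) (RzOfRecord F 2) (ZtOfRecord F 2) Efl logz).τ9.M j X) = true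 →
        Sect2.ofBackgroundC (settingOfRecord₁₃Chi F 2 (theta13LiveOfNumericsZAx F 2 n ε₂₉ (zeta316OfRecord F 2 n.ν n.τ9.M n.A₁) (RzOfRecord F 2) (ZtOfRecord F 2) Efl logz) (chiFixed29Ax F 2 n.ν ε₂₉) p).ι (UbgOfRecord₁₃CoPChi F 2 (theta13LiveOfNumericsZAx F 2 n ε₂₉ (zeta316OfRecord F 2 n.ν n.τ9.M n.A₁) (RzOfRecord F 2) (ZtOfRecord F 2) Efl logz) (chiFixed29Ax F 2 n.ν ε₂₉) p m s W) ∈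
          Sect2.spaceMS (settingOfRecord₁₃Chi F 2 (theta13LiveOfNumericsZAx F 2 n ε₂₉ (zeta316OfRecord F 2 n.ν n.τ9.M n.A₁) (RzOfRecord F 2) (ZtOfRecord F 2) Efl logz) (chiFixed29Ax F 2 n.ν ε₂₉) p) ((theta13LiveOfNumericsZAx F 2 n ε₂₉ (zeta316OfRecord F 2 n.ν n.τ9.M n.A₁) (RzOfRecord F 2) (ZtOfRecord F 2) Efl logz).Rz p.K) (theta13LiveOfNumericsZAx F 2 n ε₂₉ (zeta316OfRecord F 2 n.ν n.τ9.M n.A₁) (RzOfRecord F 2) (ZtOfRecord F 2) Efl logz).τ9.M j (Sect2.domSites (F.P p.K) (theta13LiveOfNumericsZAx F 2 n ε₂₉ (zeta316OfRecord F 2 n.ν n.τ9.M n.A₁) (RzOfRecord F 2) (ZtOfRecord F 2) Efl logz).τ9.M j X) s.Ω)) :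
    ∃ θ : Stage13HParams F 2, θ.Provisos₁₃SepCoPHAx F 2 ∧ (θ.ZhUnity F 2 ∧ θ.SlotsNondegenerate₁₃Ax F 2) ∧ θ.Admissible F 2 :=
  exists_k0SepCoPH_of_exists_k0SepCoP_ax (exists_k0SepCoP_of_bgSepCoP_theta13LiveOfNumericsZAx F hn hε' hM hM₁ hbgSepCoP)

end Ax

end Literature.MathematicalPhysics.QuantumFieldTheory.Balaban1983to89.Node00

end
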